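import Summits.QuantumFields.YangMills.Theorems.BalabanUVNodesN21HistoriesConditionalCloseness

/-!
# YM-DAG node N21 (= NE7c) — ROW A⁶-S «THE ABSORBING CURRENCY» (lens Cards 22–25): `Absorbing` term laws (the fixed points of the leaf's `histLaw`), the TOWER weights of
# def-T's shape (χ's AND history-dependent step weights interleaved) with tower unity and absorption BY SUPPORT, sub-resummation + total mass = resummation, and model A
# in the absorbing currency (`fullLaw`) — the lens's `Sketch-nearmiss-g8.lean` §A2 ∕ §B ∕ §B′ ∕ §D VERBATIM; the definition-lane support leaf of module 20l (§C rides in 20l)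

Track A of `YM-PLAN.md` (cell `pub-ymgap`, HUMAN RULING D-0062), node **N21**; R134 fan-out seat `pub-ymgap-dag-n21-d` (s2), generation 6, module 20k (definition lane, as 20f ∕ 20h).
4 `def` + 33 theorems, 0 `sorry`, 0 `instance`, 0 `notation`, standard axioms; COUNT-NEUTRAL; KEY-FREE; `--supports` the K3⁗ item `SpineGivenEndpointR13Sep` (stmt-QuantumFields-20292)
as a helper.  NO Theses import, NO `Node00.Record13` import.  THIS FILE IS the planner seat `ym-lens-BalabanUVNodes-nearmiss` g8's farm-checked sketch `Sketch-nearmiss-g8.lean`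
(sha16 3aad32c4939bea33) §A2 ∕ §B ∕ §B′ ∕ §D VERBATIM (namespace renamed; §C = three theorems, no def, rides in the theorems-only module 20l; CREDIT: ym-lens-BalabanUVNodes-nearmiss g8, memo `LENS-nearmiss.md` v8.0 850d044907e0bb17, Cards 22–25,
FAN-OUT ROW A⁶), as 18a ∕ 20b ∕ 20e ∕ 20f ∕ 20g ∕ 20h were earlier generations'.  Imports module 20g `BalabanUVNodesN21HistoriesConditionalCloseness` (p505759: `histLaw_restrict`,
`ae_restrict_smallEvent_iff`; brings 20h `smallEvent` ∕ `modelAWeightW` …, 20f `causalFactor` ∕ `modelAWeight` ∕ `sum_histLaw_modelA`, 20e, 23b, 23c).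

THE POINT (lens v8.0, finding W⁶ ∕ census sss).  Module 20i closes the histories road for term objects of model-A(W) shape = products of INDICATOR factors against ONE
history-blind law `γ_t`; print's T-operation ([Balaban1988Convergent] (3.1)) interleaves HISTORY-DEPENDENT step weights `w_k(s′)` ((3.2)(3.3)ζ = def-T's `wOfRecordAt`, ≢ 1)
between the χ's, which model A(W) has no room for — the (2.18) term object is of TOWER shape.  Repair = remove the constructor from the interface:
* §A2 ABSORBING INTERFACE — `histLaw ν sm u ϑ = ν.restrict (smallEvent …)` (`histLaw_eq_restrict`); `Absorbing ν sm u ϑ :⇔ ν-a.e. every slot of sm is small` ⇔ `histLaw ν = ν`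
  (`histLaw_eq_self_of_absorbing`, `histLaw_histLaw`); at an absorbing law the leaf's letters ARE print's term masses (`histWeight_of_absorbing`: `A = ν(univ)`,
  `histShell_of_absorbing`, `histPiece_of_absorbing`); `Σ_τ histLaw ν_τ = Σ_τ ν_τ` (`sum_histLaw_eq_of_absorbing`); `ae_close_of_absorbing` (absorbing ⇒ UNCONDITIONAL
  a.e. closeness from N16's pointwise `hdet` + the geometry `hgeom`).
* §B TOWER UNITY + MODEL T — `towerWeight` (`W_0 = w₀`, `W_{k+1}(s′) = w_k(s′)·W_k(init s′)`): `sum_towerWeight_eq` ∕ `sum_withDensity_towerWeight` (`Σ_{s:Seq k} γ·W_k(s) = γ` from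
  a.e. level-0 unity + a.e. WEIGHTED step unity; `stepUnity_of_front` = def-T's `IsStepUnity` front-weighted form ⇒ weighted form); §B′ ABSORBING BY SUPPORT `absorbing_towerLaw`
  (`W_k(s) x ≠ 0 ⇒` all `chainSlots k s` small) — so NODE O meets the interface with two LOCAL facts per step already in the tree at letters (`isStepUnity_wOfRecordAt`,
  `front_absorb_at`, def-T p506183) + Markov kernels.
* §D model A in the absorbing currency: `fullLaw`, `sum_fullLaw`, `absorbing_fullLaw(_window)`, `histLaw_modelAWeight(W)` (`histLaw (modelAWeightW γ W live u ϑ τ) (liveSmallW …) =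
  fullLaw γ live u ϑ τ` for EVERY window) — module 20i's family IS an instance; both roads agree on model A.

HONEST FRAMING (binding).  [folklore] `Measure.restrict` ∕ `withDensity` ∕ finite sums on the cell's typed letters; a CURRENCY and two MODEL constructors (nothing of Bałaban's
expansion is typed or asserted; whether NODE O's typed tower meets `hunit`∕`hw`∕`hsum` is its (t-n⁵) question); (M1) at FIXED thresholds untouched; NE7c is NOT PRINTED and NOT
PROVED; **N21 is NOT discharged**; K3⁗ NOT claimed; typed 28∕28, discharged count untouched; one finite four-torus programme at fixed `ε` — NOT ℝ⁴, NOT infinite volume, NOT OS, NOT a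
mass gap, NOT Clay.  No decl below carries a cite tag.
-/

set_option autoImplicit false

noncomputable section

open scoped BigOperators ENNReal
open MeasureTheory Set

namespace Summit.QuantumFields.YangMills.Theorems.N21HistoriesAbsorbingDefs

open Literature.MathematicalPhysics.QuantumFieldTheory.Balaban1983to89
open Literature.MathematicalPhysics.QuantumFieldTheory.Balaban1983to89.T4IndicatorShell (smallInd smallInd_nonneg smallInd_le_one ShellWeightBound)
open T4ShellMeasureLevels (LevelLedger LiveWindow)
open Summit.QuantumFields.BalabanUV.T4Continuum.ShellMeasureRootCompositionPush (measurable_smallInd)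
open Summit.QuantumFields.BalabanUV.T4Continuum.ShellMeasureRootCompositionHistories
  (smallProd smallProd_nonneg smallProd_le_one measurable_smallProd histWeight histShell histPiece histLaw)
open Summit.QuantumFields.YangMills.Theorems.N21SelectedThresholdsHistoriesResummation
  (levelLedgers_histories_of_resummation shellWeightBound_histories_of_resummation)
open Summit.QuantumFields.YangMills.Theorems.N21HistoriesModelADefs
  (causalFactor causalFactor_nonneg measurable_causalFactor liveSmall restFactor restFactor_nonneg measurable_restFactor
    restFactor_mul_smallProd modelAWeight sum_histLaw_modelA withDensity_finsetSum')
open Summit.QuantumFields.YangMills.Theorems.N21HistoriesWindowedModelADefs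
  (smallEvent smallProd_eq_one_of_mem smallProd_eq_zero_of_not_mem measurableSet_smallEvent causalFactor_le_one
    liveSmallW restFactorW modelAWeightW liveSmallW_subset restFactorW_nonneg measurable_restFactorW restFactorW_mul_smallProd)
open Summit.QuantumFields.YangMills.Theorems.N21HistoriesConditionalCloseness (histLaw_restrict ae_restrict_smallEvent_iff)

/-! ## §A2 absorption: `histLaw` is restriction to the own small event; absorbing laws are its fixed points -/

section Absorb

variable {Ω σ : Type*} [MeasurableSpace Ω]

/-- **`histLaw ν = ν|E`**: the history's law is the weight restricted to the own small event. [folklore] -/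
theorem histLaw_eq_restrict (ν : Measure Ω) (sm : Finset σ) {u : σ → Ω → ℝ} (hu : ∀ s, Measurable (u s)) (ϑ : σ → ℝ) :
    histLaw ν sm u ϑ = ν.restrict (smallEvent sm u ϑ) := by
  rw [← withDensity_indicator_one (measurableSet_smallEvent sm hu ϑ)]
  unfold histLaw
  refine congrArg _ (funext fun ω => ?_)
  by_cases h : ω ∈ smallEvent sm u ϑ
  · rw [indicator_of_mem h, Pi.one_apply, smallProd_eq_one_of_mem h, ENNReal.ofReal_one]
  · rw [indicator_of_notMem h, smallProd_eq_zero_of_not_mem h, ENNReal.ofReal_zero]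

/-- **ABSORBING LAW** for `(sm, u, ϑ)`: ν-a.e. EVERY slot of `sm` is small — all the history's live-small indicators are already factors
of the law (print's term object: B14 (2.17)-type terms carry ALL their characteristic functions). [folklore] -/
def Absorbing (ν : Measure Ω) (sm : Finset σ) (u : σ → Ω → ℝ) (ϑ : σ → ℝ) : Prop := ∀ᵐ ω ∂ν, ∀ s ∈ sm, u s ω < ϑ s

/-- absorption passes to sub-regions. [folklore] -/
theorem Absorbing.mono {ν : Measure Ω} {sm smAll : Finset σ} {u : σ → Ω → ℝ} {ϑ : σ → ℝ} (h : Absorbing ν smAll u ϑ)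
    (hsub : sm ⊆ smAll) : Absorbing ν sm u ϑ :=
  Filter.Eventually.mono h fun _ hω s hs => hω s (hsub hs)

/-- absorption passes to larger thresholds. [folklore] -/
theorem Absorbing.of_le {ν : Measure Ω} {sm : Finset σ} {u : σ → Ω → ℝ} {a θ : σ → ℝ} (h : Absorbing ν sm u a)
    (haθ : ∀ s ∈ sm, a s ≤ θ s) : Absorbing ν sm u θ :=
  Filter.Eventually.mono h fun _ hω s hs => lt_of_lt_of_le (hω s hs) (haθ s hs)

/-- absorption passes to smaller laws. [folklore] -/
theorem Absorbing.of_measure_le {μ ν : Measure Ω} {sm : Finset σ} {u : σ → Ω → ℝ} {ϑ : σ → ℝ} (h : Absorbing ν sm u ϑ)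
    (hle : μ ≤ ν) : Absorbing μ sm u ϑ :=
  ae_mono hle h

/-- the restricted weight `ν|E` is absorbing. [folklore] -/
theorem absorbing_restrict (ν : Measure Ω) (sm : Finset σ) {u : σ → Ω → ℝ} (hu : ∀ s, Measurable (u s)) (ϑ : σ → ℝ) :
    Absorbing (ν.restrict (smallEvent sm u ϑ)) sm u ϑ :=
  ae_restrict_mem (measurableSet_smallEvent sm hu ϑ)

/-- the history's law `histLaw ν` is absorbing. [folklore] -/
theorem absorbing_histLaw (ν : Measure Ω) (sm : Finset σ) {u : σ → Ω → ℝ} (hu : ∀ s, Measurable (u s)) (ϑ : σ → ℝ) :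
    Absorbing (histLaw ν sm u ϑ) sm u ϑ := by
  rw [histLaw_eq_restrict ν sm hu ϑ]
  exact absorbing_restrict ν sm hu ϑ

/-- **`histLaw` FIXES ABSORBING LAWS.** [folklore] -/
theorem histLaw_eq_self_of_absorbing (ν : Measure Ω) (sm : Finset σ) {u : σ → Ω → ℝ} (hu : ∀ s, Measurable (u s)) (ϑ : σ → ℝ)
    (h : Absorbing ν sm u ϑ) : histLaw ν sm u ϑ = ν := by
  rw [histLaw_eq_restrict ν sm hu ϑ]
  exact Measure.restrict_eq_self_of_ae_mem h

/-- **`histLaw` IS IDEMPOTENT.** [folklore] -/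
theorem histLaw_histLaw (ν : Measure Ω) (sm : Finset σ) {u : σ → Ω → ℝ} (hu : ∀ s, Measurable (u s)) (ϑ : σ → ℝ) :
    histLaw (histLaw ν sm u ϑ) sm u ϑ = histLaw ν sm u ϑ :=
  histLaw_eq_self_of_absorbing _ sm hu ϑ (absorbing_histLaw ν sm hu ϑ)

/-- AT AN ABSORBING LAW the history weight is the term mass `ν(univ)`. [folklore] -/
theorem histWeight_of_absorbing (ν : Measure Ω) (sm : Finset σ) {u : σ → Ω → ℝ} (ϑ : σ → ℝ) (h : Absorbing ν sm u ϑ) :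
    histWeight ν sm u ϑ = (ν univ).toReal := by
  unfold histWeight
  rw [integral_congr_ae (g := fun _ => (1 : ℝ)) (Filter.Eventually.mono h fun ω hω => smallProd_eq_one_of_mem hω),
    integral_const, smul_eq_mul, mul_one]
  rfl

/-- AT AN ABSORBING LAW the shell part is the other run's large-field mass under the term law. [folklore] -/
theorem histShell_of_absorbing (ν : Measure Ω) (sm : Finset σ) {uA : σ → Ω → ℝ} (uB : σ → Ω → ℝ) (ϑ : σ → ℝ)
    (h : Absorbing ν sm uA ϑ) : histShell ν sm uA uB ϑ = ∫ ω, (1 - smallProd sm uB ϑ ω) ∂ν := by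
  unfold histShell
  exact integral_congr_ae (Filter.Eventually.mono h fun ω hω => by simp only [smallProd_eq_one_of_mem hω, one_mul])

/-- AT AN ABSORBING LAW the piece of slot `s ∈ sm` is the other run's large-field mass AT `s` under the term law. [folklore] -/
theorem histPiece_of_absorbing [DecidableEq σ] (ν : Measure Ω) {sm : Finset σ} {s : σ} (hs : s ∈ sm) {uA : σ → Ω → ℝ} (uB : σ → Ω → ℝ)
    (ϑ : σ → ℝ) (h : Absorbing ν sm uA ϑ) : histPiece ν sm uA uB ϑ s = ∫ ω, (1 - smallInd (uB s ω) (ϑ s)) ∂ν := by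
  unfold histPiece
  rw [if_pos hs]
  exact integral_congr_ae (Filter.Eventually.mono h fun ω hω => by simp only [smallProd_eq_one_of_mem hω, one_mul])

/-- **ADAPTER (i)**: for absorbing term laws, resummation of the `histLaw` letters IS the plain partition `Σ_τ ν_τ`. [folklore] -/
theorem sum_histLaw_eq_of_absorbing {ι : Type*} (T : Finset ι) (ν : ι → Measure Ω) (small : ι → Finset σ) {u : σ → Ω → ℝ}
    (hu : ∀ s, Measurable (u s)) (ϑ : σ → ℝ) (habs : ∀ τ ∈ T, Absorbing (ν τ) (small τ) u ϑ) :
    ∑ τ ∈ T, histLaw (ν τ) (small τ) u ϑ = ∑ τ ∈ T, ν τ :=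
  Finset.sum_congr rfl fun τ hτ => histLaw_eq_self_of_absorbing _ _ hu ϑ (habs τ hτ)

/-- **ADAPTER (ii) — 20e's UNCONDITIONAL `hcloseX` FROM N16-det + GEOMETRY + ABSORPTION**: deterministic closeness at every window slot `s`
whenever all slots of `nbhd s` pass their tests at the NOMINAL thresholds `θ`; `nbhd s ⊆ smAll` (enlarged large-field regions: the
determining neighbourhood of a live-small slot consists of live-small slots of the history); admissibility `a ≤ θ` on `smAll`; the law
absorbing on `smAll` at `a` ⟹ ν-a.e. `|u^A_s − u^B_s| ≤ Δ_s`, unconditionally. [folklore] -/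
theorem ae_close_of_absorbing (ν : Measure Ω) {sm smAll : Finset σ} (nbhd : σ → Finset σ) {uA uB : σ → Ω → ℝ} {a θ Δ : σ → ℝ}
    (hdet : ∀ s ∈ sm, ∀ ω, (∀ c ∈ nbhd s, uA c ω < θ c) → |uA s ω - uB s ω| ≤ Δ s)
    (hgeom : ∀ s ∈ sm, nbhd s ⊆ smAll) (haθ : ∀ c ∈ smAll, a c ≤ θ c) (habs : Absorbing ν smAll uA a) :
    ∀ s ∈ sm, ∀ᵐ ω ∂ν, |uA s ω - uB s ω| ≤ Δ s := fun s hs =>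
  Filter.Eventually.mono habs fun ω hω => hdet s hs ω fun c hc => lt_of_lt_of_le (hω c (hgeom s hs hc)) (haθ c (hgeom s hs hc))

end Absorb

/-! ## §B Card 23: tower unity — (RESUM) in the absorbing currency is iterated (weighted) step unity -/

section Tower

variable {X : Type*} (Seq : ℕ → Type*) (init : ∀ k, Seq (k + 1) → Seq k) (w₀ : Seq 0 → X → ℝ) (w : ∀ k, Seq (k + 1) → X → ℝ)

/-- THE TOWER WEIGHT accumulated along the restriction chain: `W_0(s) = w₀(s)`, `W_{k+1}(s') = w_k(s')·W_k(init s')` (def-T's class weights: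
per-step factors `χ_{k+1}(s')·a_{k+1}(s')` multiplied along `s' ↦ init s'`). [folklore] -/
def towerWeight : (k : ℕ) → Seq k → X → ℝ
  | 0 => fun s x => w₀ s x
  | k + 1 => fun s' x => w k s' x * towerWeight k (init k s') x

/-- level 0 of the tower weight is the start weight (`rfl`). [folklore] -/
@[simp] theorem towerWeight_zero (s : Seq 0) (x : X) : towerWeight Seq init w₀ w 0 s x = w₀ s x := rfl

/-- the successor level multiplies the step weight by the parent's tower weight (`rfl`). [folklore] -/
@[simp] theorem towerWeight_succ (k : ℕ) (s' : Seq (k + 1)) (x : X) :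
    towerWeight Seq init w₀ w (k + 1) s' x = w k s' x * towerWeight Seq init w₀ w k (init k s') x := rfl

/-- tower weights of nonnegative factors are nonnegative. [folklore] -/
theorem towerWeight_nonneg (hw₀ : ∀ s x, 0 ≤ w₀ s x) (hw : ∀ k s' x, 0 ≤ w k s' x) : ∀ (k : ℕ) (s : Seq k) (x : X),
    0 ≤ towerWeight Seq init w₀ w k s x
  | 0, s, x => hw₀ s x
  | k + 1, s', x => mul_nonneg (hw k s' x) (towerWeight_nonneg hw₀ hw k (init k s') x)

/-- tower weights of measurable factors are measurable. [folklore] -/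
theorem measurable_towerWeight [MeasurableSpace X] (hw₀ : ∀ s, Measurable (w₀ s)) (hw : ∀ k s', Measurable (w k s')) :
    ∀ (k : ℕ) (s : Seq k), Measurable (towerWeight Seq init w₀ w k s)
  | 0, s => hw₀ s
  | k + 1, s' => (hw k s').mul (measurable_towerWeight hw₀ hw k (init k s'))

variable [∀ k, Fintype (Seq k)] [∀ k, DecidableEq (Seq k)]

/-- **THE FIBRE IDENTITY**: WEIGHTED step unity at `(k, s, x)` — `W_k(s)·Σ_{s' ↦ s} w_k(s') = W_k(s)` (def-T's `IsStepUnity` shape: unity asked only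
ON THE SUPPORT of the parent weight) — gives `Σ_{s' : init s' = s} W_{k+1}(s') = W_k(s)`. [folklore] -/
theorem sum_fiber_towerWeight_succ (k : ℕ) (s : Seq k) (x : X)
    (hstep : towerWeight Seq init w₀ w k s x * ∑ s' ∈ Finset.univ.filter (fun s' => init k s' = s), w k s' x =
      towerWeight Seq init w₀ w k s x) :
    ∑ s' ∈ Finset.univ.filter (fun s' => init k s' = s), towerWeight Seq init w₀ w (k + 1) s' x = towerWeight Seq init w₀ w k s x := by
  rw [← hstep, Finset.mul_sum]
  refine Finset.sum_congr rfl fun s' hs' => ?_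
  rw [towerWeight_succ, (Finset.mem_filter.1 hs').2, mul_comm]

/-- **def-T's FORM ⇒ THE WEIGHTED FORM**: unity weighted by the FRONT factor only (`χ_k(s)·Σ_{s'↦s} w_k(s') = χ_k(s)`, `IsStepUnity`) and the
front factor DIVIDING the tower weight (`W_k(s) = rest_k(s)·χ_k(s)`: `χ_k(s)` is a factor of `w_{k−1}(s)`, resp. of `w₀(s)`) give §B's hypothesis. [folklore] -/
theorem stepUnity_of_front {front rest : ∀ k, Seq k → X → ℝ}
    (hfac : ∀ (k : ℕ) (s : Seq k) (x : X), towerWeight Seq init w₀ w k s x = rest k s x * front k s x)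
    (hunity : ∀ (k : ℕ) (s : Seq k) (x : X), front k s x * ∑ s' ∈ Finset.univ.filter (fun s' => init k s' = s), w k s' x = front k s x)
    (k : ℕ) (s : Seq k) (x : X) :
    towerWeight Seq init w₀ w k s x * ∑ s' ∈ Finset.univ.filter (fun s' => init k s' = s), w k s' x = towerWeight Seq init w₀ w k s x := by
  rw [hfac, mul_assoc, hunity]

/-- **TOWER UNITY**: `Σ_s w₀(s) = r` at `x` and weighted step unity at every `(k, s)` at `x` ⟹ `Σ_{s : Seq k} W_k(s) = r` at `x`, every `k`
((RESUM)'s density side = def-T's `TStepProvisos.unity` iterated — the same identity E1 owes). [folklore] -/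
theorem sum_towerWeight_eq (x : X) {r : ℝ} (h0 : ∑ s, w₀ s x = r)
    (hstep : ∀ (k : ℕ) (s : Seq k), towerWeight Seq init w₀ w k s x * ∑ s' ∈ Finset.univ.filter (fun s' => init k s' = s), w k s' x =
      towerWeight Seq init w₀ w k s x) :
    ∀ k : ℕ, ∑ s : Seq k, towerWeight Seq init w₀ w k s x = r
  | 0 => by simpa using h0
  | k + 1 => by
    rw [← Finset.sum_fiberwise Finset.univ (init k) fun s' => towerWeight Seq init w₀ w (k + 1) s' x,
      Finset.sum_congr rfl fun s _ => sum_fiber_towerWeight_succ Seq init w₀ w k s x (hstep k s)]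
    exact sum_towerWeight_eq x h0 hstep k

variable [MeasurableSpace X]

/-- **UNITY ⇒ (RESUM) FOR DENSITIES**: finitely many nonnegative measurable densities summing to `1` γ-a.e. give laws summing to `γ`. [folklore] -/
theorem sum_withDensity_eq_of_ae_sum_eq_one {ι : Type*} (T : Finset ι) (γ : Measure X) (ρ : ι → X → ℝ)
    (hρm : ∀ τ, Measurable (ρ τ)) (hρ0 : ∀ τ x, 0 ≤ ρ τ x) (h1 : ∀ᵐ x ∂γ, ∑ τ ∈ T, ρ τ x = 1) :
    ∑ τ ∈ T, γ.withDensity (fun x => ENNReal.ofReal (ρ τ x)) = γ := by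
  rw [← withDensity_finsetSum' T γ (fun τ x => ENNReal.ofReal (ρ τ x)) fun τ => (hρm τ).ennreal_ofReal]
  have h : (fun x => ∑ τ ∈ T, ENNReal.ofReal (ρ τ x)) =ᵐ[γ] 1 := Filter.Eventually.mono h1 fun x hx => by
    show ∑ τ ∈ T, ENNReal.ofReal (ρ τ x) = 1
    rw [← ENNReal.ofReal_sum_of_nonneg fun τ _ => hρ0 τ x, hx, ENNReal.ofReal_one]
  rw [withDensity_congr_ae h, withDensity_one]

/-- **(RESUM) FOR A TOWER OF TERM LAWS `γ·W_k(s)`** from unity at level `0` and weighted step unity, both γ-a.e. [folklore] -/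
theorem sum_withDensity_towerWeight (γ : Measure X) (hw₀m : ∀ s, Measurable (w₀ s)) (hwm : ∀ k s', Measurable (w k s'))
    (hw₀ : ∀ s x, 0 ≤ w₀ s x) (hw : ∀ k s' x, 0 ≤ w k s' x) (h0 : ∀ᵐ x ∂γ, ∑ s, w₀ s x = 1)
    (hstep : ∀ᵐ x ∂γ, ∀ (k : ℕ) (s : Seq k),
      towerWeight Seq init w₀ w k s x * ∑ s' ∈ Finset.univ.filter (fun s' => init k s' = s), w k s' x = towerWeight Seq init w₀ w k s x)
    (k : ℕ) : ∑ s : Seq k, γ.withDensity (fun x => ENNReal.ofReal (towerWeight Seq init w₀ w k s x)) = γ := by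
  refine sum_withDensity_eq_of_ae_sum_eq_one Finset.univ γ _ (measurable_towerWeight Seq init w₀ w hw₀m hwm k)
    (towerWeight_nonneg Seq init w₀ w hw₀ hw k) ?_
  filter_upwards [h0, hstep] with x hx hs
  exact sum_towerWeight_eq Seq init w₀ w x hx hs k

/-! ### §B′ MODEL T: tower-shaped term laws meet the absorbing interface — absorbing BY SUPPORT, resummed BY UNITY -/

/-- a density supported inside the small event of `sm` gives an absorbing law. [folklore] -/
theorem absorbing_withDensity_of_support (γ : Measure X) {ρ : X → ℝ} (hρ : Measurable ρ) {σ : Type*} (sm : Finset σ) (u : σ → X → ℝ)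
    (ϑ : σ → ℝ) (h : ∀ x, ρ x ≠ 0 → ∀ c ∈ sm, u c x < ϑ c) : Absorbing (γ.withDensity fun x => ENNReal.ofReal (ρ x)) sm u ϑ := by
  unfold Absorbing
  rw [ae_withDensity_iff hρ.ennreal_ofReal]
  exact Filter.Eventually.of_forall fun x hx => h x fun h0 => hx (by rw [h0, ENNReal.ofReal_zero])

omit [∀ k, Fintype (Seq k)] [∀ k, DecidableEq (Seq k)] [MeasurableSpace X] in
/-- on the support of a tower weight the parent's tower weight is nonzero … [folklore] -/
theorem towerWeight_init_ne_zero (k : ℕ) (s' : Seq (k + 1)) (x : X) (h : towerWeight Seq init w₀ w (k + 1) s' x ≠ 0) :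
    towerWeight Seq init w₀ w k (init k s') x ≠ 0 := fun h0 => h (by rw [towerWeight_succ, h0, mul_zero])

omit [∀ k, Fintype (Seq k)] [∀ k, DecidableEq (Seq k)] [MeasurableSpace X] in
/-- … and so is the step factor. [folklore] -/
theorem w_ne_zero_of_towerWeight_ne_zero (k : ℕ) (s' : Seq (k + 1)) (x : X) (h : towerWeight Seq init w₀ w (k + 1) s' x ≠ 0) :
    w k s' x ≠ 0 := fun h0 => h (by rw [towerWeight_succ, h0, zero_mul])

variable {σ : Type*} [DecidableEq σ] (slots : ∀ j, Seq j → Finset σ)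

/-- THE CHAIN's LIVE-SMALL SLOTS: the new live-small slots of every ancestor `s, init s, init (init s), …`. [folklore] -/
def chainSlots : (k : ℕ) → Seq k → Finset σ
  | 0 => fun s => slots 0 s
  | k + 1 => fun s' => slots (k + 1) s' ∪ chainSlots k (init k s')

omit [∀ k, Fintype (Seq k)] [∀ k, DecidableEq (Seq k)] [MeasurableSpace X] in
/-- **SUPPORT OF A TOWER WEIGHT**: if the level-0 factor vanishes wherever one of ITS live-small slots is large, and every step factor `w_k(s')`
vanishes wherever one of the NEW live-small slots of `s'` is large (each carries the front indicator `χ_{k+1}(s')` as a factor — def-T), then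
wherever `W_k(s) ≠ 0` ALL the chain's live-small slots are small. [folklore] -/
theorem small_of_towerWeight_ne_zero (u : σ → X → ℝ) (ϑ : σ → ℝ)
    (hw₀ : ∀ (s₀ : Seq 0) (x : X), w₀ s₀ x ≠ 0 → ∀ c ∈ slots 0 s₀, u c x < ϑ c)
    (hw : ∀ (j : ℕ) (s' : Seq (j + 1)) (x : X), w j s' x ≠ 0 → ∀ c ∈ slots (j + 1) s', u c x < ϑ c) :
    ∀ (k : ℕ) (s : Seq k) (x : X), towerWeight Seq init w₀ w k s x ≠ 0 → ∀ c ∈ chainSlots Seq init slots k s, u c x < ϑ c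
  | 0, s, x, h, c, hc => hw₀ s x h c hc
  | k + 1, s', x, h, c, hc => by
    rcases Finset.mem_union.1 hc with hc | hc
    · exact hw k s' x (w_ne_zero_of_towerWeight_ne_zero Seq init w₀ w k s' x h) c hc
    · exact small_of_towerWeight_ne_zero u ϑ hw₀ hw k (init k s') x (towerWeight_init_ne_zero Seq init w₀ w k s' x h) c hc

omit [∀ k, Fintype (Seq k)] [∀ k, DecidableEq (Seq k)] in
/-- **MODEL T MEETS THE ABSORBING INTERFACE (i)**: the tower term law `γ·W_k(s)` is ABSORBING on the chain's live-small slots — by support, no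
computation. ((ii), resummation, is `sum_withDensity_towerWeight`.) [folklore] -/
theorem absorbing_towerLaw (γ : Measure X) (u : σ → X → ℝ) (ϑ : σ → ℝ) (hw₀m : ∀ s, Measurable (w₀ s)) (hwm : ∀ k s', Measurable (w k s'))
    (hw₀ : ∀ (s₀ : Seq 0) (x : X), w₀ s₀ x ≠ 0 → ∀ c ∈ slots 0 s₀, u c x < ϑ c)
    (hw : ∀ (j : ℕ) (s' : Seq (j + 1)) (x : X), w j s' x ≠ 0 → ∀ c ∈ slots (j + 1) s', u c x < ϑ c) (k : ℕ) (s : Seq k) :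
    Absorbing (γ.withDensity fun x => ENNReal.ofReal (towerWeight Seq init w₀ w k s x)) (chainSlots Seq init slots k s) u ϑ :=
  absorbing_withDensity_of_support γ (measurable_towerWeight Seq init w₀ w hw₀m hwm k s) _ u ϑ
    (small_of_towerWeight_ne_zero Seq init w₀ w slots u ϑ hw₀ hw k s)

end Tower

/-! ## §D model A in the absorbing currency: the FULL term law -/

section FullLaw

variable {Ω : Type*} [MeasurableSpace Ω] {n : ℕ}

/-- **THE FULL TERM LAW** of history `τ` in model A: ALL factors inside — `fullLaw_τ := (∏_i causalFactor(live τ i, τ i, χ_{ϑ i}(u_i)))·γ`. [folklore] -/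
noncomputable def fullLaw (γ : Measure Ω) (live : (Fin n → Bool) → Fin n → Bool) (u : Fin n → Ω → ℝ) (ϑ : Fin n → ℝ)
    (τ : Fin n → Bool) : Measure Ω :=
  γ.withDensity fun ω => ENNReal.ofReal (∏ i, causalFactor (live τ i) (τ i) (smallInd (u i ω) (ϑ i)))

/-- the full factor product is measurable. [folklore] -/
theorem measurable_fullProd (live : (Fin n → Bool) → Fin n → Bool) (τ : Fin n → Bool) {u : Fin n → Ω → ℝ}
    (hu : ∀ i, Measurable (u i)) (ϑ : Fin n → ℝ) :
    Measurable fun ω => ∏ i, causalFactor (live τ i) (τ i) (smallInd (u i ω) (ϑ i)) :=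
  Finset.measurable_prod _ fun i _ => (measurable_causalFactor (live τ i) (τ i)).comp (measurable_smallInd (hu i) (ϑ i))

/-- **`histLaw` OF 20f's (BLIND) MODEL-A WEIGHT IS THE FULL TERM LAW.** [folklore] -/
theorem histLaw_modelAWeight (γ : Measure Ω) (live : (Fin n → Bool) → Fin n → Bool) {u : Fin n → Ω → ℝ} (hu : ∀ i, Measurable (u i))
    (ϑ : Fin n → ℝ) (τ : Fin n → Bool) : histLaw (modelAWeight γ live u ϑ τ) (liveSmall live τ) u ϑ = fullLaw γ live u ϑ τ := by
  unfold histLaw modelAWeight fullLaw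
  rw [← withDensity_mul _ (measurable_restFactor live τ hu ϑ).ennreal_ofReal (measurable_smallProd _ hu ϑ).ennreal_ofReal]
  refine congrArg _ (funext fun ω => ?_)
  simp only [Pi.mul_apply]
  rw [← ENNReal.ofReal_mul (restFactor_nonneg live τ u ϑ ω), restFactor_mul_smallProd]

/-- **… AND OF 20h's WINDOWED WEIGHT, FOR EVERY WINDOW**: the term law does not depend on the window — the window only decides which indicators
the LETTERS refine against the other run. [folklore] -/
theorem histLaw_modelAWeightW (γ : Measure Ω) (W : Finset (Fin n)) (live : (Fin n → Bool) → Fin n → Bool) {u : Fin n → Ω → ℝ}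
    (hu : ∀ i, Measurable (u i)) (ϑ : Fin n → ℝ) (τ : Fin n → Bool) :
    histLaw (modelAWeightW γ W live u ϑ τ) (liveSmallW W live τ) u ϑ = fullLaw γ live u ϑ τ := by
  unfold histLaw modelAWeightW fullLaw
  rw [← withDensity_mul _ (measurable_restFactorW W live τ hu ϑ).ennreal_ofReal (measurable_smallProd _ hu ϑ).ennreal_ofReal]
  refine congrArg _ (funext fun ω => ?_)
  simp only [Pi.mul_apply]
  rw [← ENNReal.ofReal_mul (restFactorW_nonneg W live τ u ϑ ω), restFactorW_mul_smallProd]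

/-- **(RESUM) FOR THE FULL TERM LAWS**: `Σ_τ fullLaw_τ = γ` (causal liveness; 20f `sum_histLaw_modelA`). [folklore] -/
theorem sum_fullLaw (γ : Measure Ω) (live : (Fin n → Bool) → Fin n → Bool)
    (hc : ∀ τ τ' i, (∀ j, j < i → τ j = τ' j) → live τ i = live τ' i) {u : Fin n → Ω → ℝ} (hu : ∀ i, Measurable (u i))
    (ϑ : Fin n → ℝ) : ∑ τ : Fin n → Bool, fullLaw γ live u ϑ τ = γ :=
  calc ∑ τ : Fin n → Bool, fullLaw γ live u ϑ τ = ∑ τ : Fin n → Bool, histLaw (modelAWeight γ live u ϑ τ) (liveSmall live τ) u ϑ :=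
      Finset.sum_congr rfl fun τ _ => (histLaw_modelAWeight γ live hu ϑ τ).symm
    _ = γ := sum_histLaw_modelA γ live hc hu ϑ

/-- **THE FULL TERM LAW IS ABSORBING ON THE WHOLE LIVE-SMALL REGION** (window AND UV slots). [folklore] -/
theorem absorbing_fullLaw (γ : Measure Ω) (live : (Fin n → Bool) → Fin n → Bool) {u : Fin n → Ω → ℝ} (hu : ∀ i, Measurable (u i))
    (ϑ : Fin n → ℝ) (τ : Fin n → Bool) : Absorbing (fullLaw γ live u ϑ τ) (liveSmall live τ) u ϑ := by
  unfold Absorbing fullLaw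
  rw [ae_withDensity_iff (measurable_fullProd live τ hu ϑ).ennreal_ofReal]
  refine Filter.Eventually.of_forall fun ω hω i hi => ?_
  simp only [liveSmall, Finset.mem_filter, Finset.mem_univ, true_and] at hi
  by_contra hlt
  refine hω ?_
  rw [ENNReal.ofReal_eq_zero]
  refine le_of_eq (Finset.prod_eq_zero (Finset.mem_univ i) ?_)
  simp [hi.1, hi.2, smallInd, hlt]

/-- **`histLaw` FIXES THE FULL TERM LAW** on every sub-region of the live-small region (in particular on its window part). [folklore] -/
theorem histLaw_fullLaw (γ : Measure Ω) (live : (Fin n → Bool) → Fin n → Bool) {u : Fin n → Ω → ℝ} (hu : ∀ i, Measurable (u i))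
    (ϑ : Fin n → ℝ) (τ : Fin n → Bool) {sm : Finset (Fin n)} (hsm : sm ⊆ liveSmall live τ) :
    histLaw (fullLaw γ live u ϑ τ) sm u ϑ = fullLaw γ live u ϑ τ :=
  histLaw_eq_self_of_absorbing _ sm hu ϑ ((absorbing_fullLaw γ live hu ϑ τ).mono hsm)

/-- the full term laws are finite when `γ` is (density `≤ 1`). [folklore] -/
theorem isFiniteMeasure_fullLaw (γ : Measure Ω) [IsFiniteMeasure γ] (live : (Fin n → Bool) → Fin n → Bool) (u : Fin n → Ω → ℝ)
    (ϑ : Fin n → ℝ) (τ : Fin n → Bool) : IsFiniteMeasure (fullLaw γ live u ϑ τ) := by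
  have h : ∫⁻ ω, ENNReal.ofReal (∏ i, causalFactor (live τ i) (τ i) (smallInd (u i ω) (ϑ i))) ∂γ ≤ ∫⁻ _, 1 ∂γ :=
    lintegral_mono fun ω => ENNReal.ofReal_le_one.2 (Finset.prod_le_one
      (fun i _ => causalFactor_nonneg _ _ (smallInd_nonneg _ _) (smallInd_le_one _ _))
      fun i _ => causalFactor_le_one _ _ (smallInd_nonneg _ _) (smallInd_le_one _ _))
  rw [lintegral_one] at h
  unfold fullLaw
  exact isFiniteMeasure_withDensity (ne_of_lt (lt_of_le_of_lt h (measure_lt_top γ univ)))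

/-- **THE WINDOWED FAMILY IN THE ABSORBING CURRENCY**: 20i's encoded family `modelAWeightW γ W live u ϑ τ` and the full term law have the SAME letters
(`histLaw` agrees, hence `histWeight`∕`histShell`∕`histPiece` — 20g's blindness), and the full term law is absorbing on ALL of `liveSmall τ ⊇ liveSmallW W τ`:
so 20e∕23c apply to `fullLaw` with the UNCONDITIONAL closeness of `ae_close_of_absorbing` (no `_condCloseness` variant needed). [folklore] -/
theorem absorbing_fullLaw_window (γ : Measure Ω) (W : Finset (Fin n)) (live : (Fin n → Bool) → Fin n → Bool) {u : Fin n → Ω → ℝ}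
    (hu : ∀ i, Measurable (u i)) (ϑ : Fin n → ℝ) (τ : Fin n → Bool) :
    Absorbing (fullLaw γ live u ϑ τ) (liveSmallW W live τ) u ϑ :=
  (absorbing_fullLaw γ live hu ϑ τ).mono fun i hi => by
    simp only [liveSmallW, liveSmall, Finset.mem_filter, Finset.mem_univ, true_and] at hi ⊢
    exact hi.1

end FullLaw

end Summit.QuantumFields.YangMills.Theorems.N21HistoriesAbsorbingDefs

end
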